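import Literature.Geometry.Lorentzian.KerrLeafEnergyComparison
import Literature.Geometry.Lorentzian.KerrSchildTruncatedCurrent
import Literature.Geometry.Lorentzian.KerrSchildMultiplierPerturbation
import Literature.Geometry.Lorentzian.KerrFiniteSpeedOfPropagation
import HarnessLib

/-!
# The far region of the Kerr exterior in the Kerr–Schild chart: radial cut-offs, the wave and
# its currents there, and the support of an admissible wave below a time level

(family `gr`; infrastructure for the far-region estimates behind statement **gr.S24** —
Dafermos–Rodnianski–Shlapentokh-Rothman, arXiv:1402.7034 = Ann. of Math. 183 (2016), §2.3, §4.1,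
§4.6; Moschidis arXiv:1509.08489, §4 — namespace `Literature.Geometry.Lorentzian.Kerr`)

Every far-region energy estimate for an admissible wave `ψ` on subextremal Kerr
(`IsAdmissibleKerrWave`: smooth solution of `□_g ψ = 0` on the exterior `{r > r₊}` with data
compactly supported in the open slice `{t* = 0, r > r₊}`) — the `∂_{t*}`-energy inequality between
two hyperboloidal leaves (Moschidis Lemma 4.5), the large-`r` Morawetz estimate (Lemma 4.1,
DRSR Prop. 4.6.1) and the `r^p` estimates (Thm. 5.1) behind `Kerr.dafermosRodnianski_pHierarchy_scri`
— runs the divergence identity of `KerrSchildTruncatedCurrent.lean`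
(`KerrSchild.cutoffModifiedCurrent_graph_identity_timeCutoff`) for a current
`f · (J^X + ¼L_ϖ)[ψ̃]` built from the extension by zero `ψ̃` of `ψ` to `ℝ⁴`, the Kerr inverse
metric `g⁻¹_{M,a}` (`Kerr.inverseMetric`) and a **radial cut-off `f(x) = u(x⃗)` to the far region**
`{‖x⃗‖ ≥ R'}`, `R' > R_af = Kerr.afRadius a r₊` (beyond which every point of `ℝ⁴` lies in the
exterior chart, `Kerr.mem_slice_of_lt_norm`). This file collects, once and for all, the
hypotheses of that identity and the pointwise facts shared by all these estimates:

* the far region: `Kerr.mem_region_of_afRadius_lt_spatialNorm` (`‖x⃗‖ > R_af ⇒ r(x) > r₊`),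
  `Kerr.eight_mul_le_radius_of_le_spatialNorm` (`‖x⃗‖ ≥ 9M ⇒ r ≥ 8M` for `|a| < M`), whence
  `H ≤ 1/8` there (`Kerr.scalarH_le_one_div_eight`, `KerrLeafEnergyComparison.lean`);
* cut-offs `x ↦ u(x⃗)` of a function `u` on `E3` (`Kerr.contDiff_comp_spatial`,
  `Kerr.fderiv_comp_spatial_basisVector`, `Kerr.abs_fderiv_comp_spatial_basisVector_le`,
  `Kerr.tsupport_comp_spatial_subset`): smoothness, `∂_μ f = du(x⃗)(e⃗_μ)`, `|∂_μ f| ≤ ‖du(x⃗)‖`,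
  and `tsupport f ⊆ {‖x⃗‖ ≥ c}` when `u = 0` on `{‖y‖ < c}`;
* the wave in the far region (`Kerr.IsAdmissibleKerrWave.contDiffAt_extend_of_mem`,
  `….waveOperator_extend_eq_zero`, `….multiplierBulk_timeTranslation_extend_eq_zero`): `ψ̃` is
  `C^∞` at exterior points, `□_{g⁻¹} ψ̃ = 0` there (`KerrSchild.waveOperator` is `□_g` in the chart,
  `Kerr.dalembertian_eq_divergence`), and the bulk of the Killing multiplier `∂_{t*}` vanishes
  (`∂_0 g^{αβ} = 0`);
* **support below a time level** (`Kerr.IsAdmissibleKerrWave.exists_extend_eq_zero_of_lt`): there is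
  `ρ₀ ≥ 0` such that `ψ̃(x) = 0` and `dψ̃(x) = 0` at every point with `x⁰ ≥ 0` and
  `‖x⃗‖ > ρ₀ + x⁰` (finite speed of propagation in the ingoing chart,
  `kerr_finite_speed_of_propagation_holds`, from the compact support of the data) — this discharges
  the hypothesis `hfar` of `KerrSchild.cutoffModifiedCurrent_graph_identity_timeCutoff` on every wedge
  `{τ + F ≤ x⁰ ≤ τ + h + F}` with `τ ≥ 0`, `F ≥ 0`, below any time level `T`, with `ρ = ρ₀ + T`;
* **the cut-off error is a local energy** (`Kerr.abs_sum_multiplierCurrent_mul_fderiv_le`): for a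
  multiplier with `|X^α| ≤ ξ₀` and a cut-off with `|∂_μ f| ≤ ν₀`, at exterior points with `2H ≤ 1`,
  `|∑_μ (J^X)^μ ∂_μ f| ≤ 48 ξ₀ ν₀ ∑_μ (∂_μψ̃)²`, and `∑_μ (∂_μψ̃)² ≤ 4 T[ψ](V, V)`
  (`Kerr.coordEnergyDensity_le_four_mul_stressEnergy`) — on the collar `{R' ≤ ‖y‖ ≤ 2R'} ⊆ {‖y‖ ≤ R₁}`
  the leaves `Σ̃_τ(h♯_{R₁})` are the slices and `T[ψ](V, V) dy` is their flux density
  (`Kerr.leafFluxDensity_scriHeight_of_norm_le`), so these errors are bounded by the local fluxes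
  `Kerr.localLeafFlux` entering `Kerr.localError`.

No definitions, no named facts (D-0026).

## References

* M. Dafermos, I. Rodnianski, Y. Shlapentokh-Rothman, arXiv:1402.7034 = Ann. of Math. 183 (2016),
  §2.3 (currents, cut-offs: Remark 2.3.1), §4.1 (reduction to compactly supported data), §4.6
  (key `DafermosRodnianskiShlapentokhrothman2014`).
* G. Moschidis, arXiv:1509.08489 = Ann. PDE 2 (2016), §4 (Lemmas 4.1, 4.5: the cut-off `χ_R` and
  the error terms `∫ |∂χ_R| (|∂φ|² + r⁻²φ²)`) (key `Moschidis2016`).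
-/

noncomputable section

open Bundle Set TopologicalSpace Filter MeasureTheory
open scoped Manifold ContDiff Topology ENNReal

namespace Literature.Geometry.Lorentzian

namespace Kerr

/-! ### The far region `{‖x⃗‖ > R_af}` of the chart lies in the exterior -/

/-- **Every point of `ℝ⁴` with `‖x⃗‖ > R_af = Kerr.afRadius a r₊` lies in the exterior chart
`{r > r₊}`** (`Kerr.mem_slice_of_lt_norm` for its spatial part; the region is invariant under time
translations). [folklore] -/
theorem mem_region_of_afRadius_lt_spatialNorm {M a : ℝ} {x : E4}
    (hx : afRadius a (rPlus M a) < E4.spatialNorm x) : x ∈ region a (rPlus M a) := by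
  rw [eq_ofTimeSpace x, ofTimeSpace_mem_region_iff]
  exact mem_slice_of_lt_norm (by simpa [E4.spatialNorm] using hx)

/-- **`r ≥ 8M` where `‖x⃗‖ ≥ 9M`**, for `|a| < M` (`r² ≥ ‖x⃗‖² − a² ≥ 81M² − M² ≥ 64M²`).
[folklore] -/
theorem eight_mul_le_radius_of_le_spatialNorm {M a : ℝ} (hMa : IsSubextremal M a) {x : E4}
    (hx : 9 * M ≤ E4.spatialNorm x) : 8 * M ≤ radius a x := by
  have hM : 0 < M := hMa.pos
  have ha : a ^ 2 < M ^ 2 := hMa.sq_lt_sq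
  have h1 := spatialNorm_sq_sub_sq_le_radius_sq a x
  have hsq : (9 * M) ^ 2 ≤ E4.spatialNorm x ^ 2 := pow_le_pow_left₀ (by positivity) hx 2
  have hr2 : (8 * M) ^ 2 ≤ radius a x ^ 2 := by nlinarith
  nlinarith [radius_nonneg a x]

/-- `H ≤ 1/8` where `‖x⃗‖ ≥ 9M`, for `|a| < M`. [folklore] -/
theorem scalarH_le_one_div_eight_of_le_spatialNorm {M a : ℝ} (hMa : IsSubextremal M a) {x : E4}
    (hx : 9 * M ≤ E4.spatialNorm x) : scalarH M a x ≤ 1 / 8 := by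
  have hr := eight_mul_le_radius_of_le_spatialNorm hMa hx
  have hr0 : 0 < radius a x := lt_of_lt_of_le (by linarith [hMa.pos]) hr
  exact scalarH_le_one_div_eight hMa.pos.le hr0 hr

/-! ### Cut-offs `x ↦ u(x⃗)` of functions on `E3` -/

/-- A cut-off `x ↦ u(x⃗)` is as smooth as `u`. [folklore] -/
theorem contDiff_comp_spatial {u : E3 → ℝ} {n : WithTop ℕ∞} (hu : ContDiff ℝ n u) :
    ContDiff ℝ n fun x : E4 ↦ u (E4.spatial x) :=
  hu.comp E4.spatial.contDiff

/-- `∂_v [u(x⃗)] = du_{x⃗}(v⃗)`. [folklore] -/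
theorem fderiv_comp_spatial_apply {u : E3 → ℝ} {x : E4} (hu : DifferentiableAt ℝ u (E4.spatial x))
    (v : E4) : fderiv ℝ (fun x : E4 ↦ u (E4.spatial x)) x v = fderiv ℝ u (E4.spatial x) (E4.spatial v) := by
  rw [fderiv_fun_comp x hu E4.spatial.differentiableAt, E4.spatial.fderiv]
  rfl

/-- The spatial part of a coordinate vector has norm `≤ 1` (`e⃗₀ = 0`, `e⃗_{i+1} = e_i`).
[folklore] -/
theorem norm_spatial_basisVector_le_one (μ : Fin 4) : ‖E4.spatial (E4.basisVector μ)‖ ≤ 1 := by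
  refine Fin.cases ?_ (fun i ↦ ?_) μ
  · rw [E4.spatial_basisVector_zero, norm_zero]
    exact zero_le_one
  · rw [E4.spatial_basisVector_succ, PiLp.norm_single, norm_one]

/-- **`|∂_μ [u(x⃗)]| ≤ ‖du_{x⃗}‖`** (operator norm). [folklore] -/
theorem abs_fderiv_comp_spatial_basisVector_le {u : E3 → ℝ} {x : E4}
    (hu : DifferentiableAt ℝ u (E4.spatial x)) (μ : Fin 4) :
    |fderiv ℝ (fun x : E4 ↦ u (E4.spatial x)) x (E4.basisVector μ)| ≤ ‖fderiv ℝ u (E4.spatial x)‖ := by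
  rw [fderiv_comp_spatial_apply hu, ← Real.norm_eq_abs]
  calc ‖fderiv ℝ u (E4.spatial x) (E4.spatial (E4.basisVector μ))‖
      ≤ ‖fderiv ℝ u (E4.spatial x)‖ * ‖E4.spatial (E4.basisVector μ)‖ :=
        ContinuousLinearMap.le_opNorm _ _
    _ ≤ ‖fderiv ℝ u (E4.spatial x)‖ * 1 := by
        gcongr
        exact norm_spatial_basisVector_le_one μ
    _ = _ := mul_one _

/-- At a point off the topological support of `u ∘ spatial`, the cut-off and its derivative vanish
(so does `∂_μ f`). [folklore] -/
theorem fderiv_comp_spatial_basisVector_eq_zero {u : E3 → ℝ} {x : E4}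
    (hx : x ∉ tsupport fun x : E4 ↦ u (E4.spatial x)) (μ : Fin 4) :
    fderiv ℝ (fun x : E4 ↦ u (E4.spatial x)) x (E4.basisVector μ) = 0 := by
  rw [fderiv_of_notMem_tsupport ℝ hx]
  rfl

/-- **The support of a far cut-off**: if `u = 0` on `{‖y‖ < c}`, then
`tsupport (x ↦ u(x⃗)) ⊆ {‖x⃗‖ ≥ c}`. [folklore] -/
theorem tsupport_comp_spatial_subset {u : E3 → ℝ} {c : ℝ} (hu : ∀ y : E3, ‖y‖ < c → u y = 0) :
    tsupport (fun x : E4 ↦ u (E4.spatial x)) ⊆ {x : E4 | c ≤ E4.spatialNorm x} := by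
  have hclosed : IsClosed {x : E4 | c ≤ E4.spatialNorm x} :=
    isClosed_le continuous_const (continuous_norm.comp E4.spatial.continuous)
  refine closure_minimal (fun x hx ↦ ?_) hclosed
  by_contra h
  simp only [Set.mem_setOf_eq, not_le] at h
  exact hx (hu _ h)

/-! ### The radial transition `u_{R',R'}` as the far cut-off -/

/-- The far cut-off `f(x) = u_{R',R'}(x⃗)` (`radialTransition`: `0` for `‖x⃗‖ ≤ R'`, `1` for
`‖x⃗‖ ≥ 2R'`) is `C^∞` for `R' > 0`. [folklore] -/
theorem contDiff_radialTransition_comp_spatial {R' : ℝ} (hR' : 0 < R') {n : ℕ∞} :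
    ContDiff ℝ n fun x : E4 ↦ radialTransition R' R' (E4.spatial x) :=
  contDiff_comp_spatial (contDiff_radialTransition hR' hR')

/-- `tsupport f ⊆ {‖x⃗‖ ≥ R'}` for the far cut-off. [folklore] -/
theorem tsupport_radialTransition_comp_spatial_subset {R' : ℝ} (hR' : 0 < R') :
    tsupport (fun x : E4 ↦ radialTransition R' R' (E4.spatial x)) ⊆
      {x : E4 | R' ≤ E4.spatialNorm x} :=
  tsupport_comp_spatial_subset fun _ hy ↦ radialTransition_of_norm_le hR' hy.le

/-- `f = 1` for `‖x⃗‖ ≥ 2R'`. [folklore] -/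
theorem radialTransition_comp_spatial_of_le {R' : ℝ} (hR' : 0 < R') {x : E4}
    (hx : 2 * R' ≤ E4.spatialNorm x) : radialTransition R' R' (E4.spatial x) = 1 :=
  radialTransition_of_le_norm hR' (by simpa [E4.spatialNorm, two_mul] using hx)

/-- `f = 0` for `‖x⃗‖ ≤ R'`. [folklore] -/
theorem radialTransition_comp_spatial_of_norm_le {R' : ℝ} (hR' : 0 < R') {x : E4}
    (hx : E4.spatialNorm x ≤ R') : radialTransition R' R' (E4.spatial x) = 0 :=
  radialTransition_of_norm_le hR' (by simpa [E4.spatialNorm] using hx)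

/-- **`|∂_μ f| ≤ K/R'`** for the far cut-off, `K` any bound for `|χ'|`
(`Kerr.exists_bound_deriv_smoothTransition`). [folklore] -/
theorem abs_fderiv_radialTransition_comp_spatial_le {R' K : ℝ} (hR' : 0 < R')
    (hK : ∀ t, |deriv Real.smoothTransition t| ≤ K) (x : E4) (μ : Fin 4) :
    |fderiv ℝ (fun x : E4 ↦ radialTransition R' R' (E4.spatial x)) x (E4.basisVector μ)| ≤ K / R' := by
  have hd : DifferentiableAt ℝ (radialTransition R' R') (E4.spatial x) :=
    ((contDiff_radialTransition hR' hR' (n := 1)).differentiable one_ne_zero).differentiableAt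
  exact (abs_fderiv_comp_spatial_basisVector_le hd μ).trans
    (norm_fderiv_radialTransition_le hR' hR' hK _)

/-- The derivative of the far cut-off is supported in the collar `{R' ≤ ‖x⃗‖ ≤ 2R'}`: it vanishes
where `‖x⃗‖ < R'` or `‖x⃗‖ > 2R'` (there `f` is locally constant). [folklore] -/
theorem fderiv_radialTransition_comp_spatial_eq_zero {R' : ℝ} (hR' : 0 < R') {x : E4}
    (hx : E4.spatialNorm x < R' ∨ 2 * R' < E4.spatialNorm x) (μ : Fin 4) :
    fderiv ℝ (fun x : E4 ↦ radialTransition R' R' (E4.spatial x)) x (E4.basisVector μ) = 0 := by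
  have hcont : Continuous fun z : E4 ↦ E4.spatialNorm z := continuous_norm.comp E4.spatial.continuous
  rcases hx with h | h
  · have hev : (fun x : E4 ↦ radialTransition R' R' (E4.spatial x)) =ᶠ[𝓝 x] fun _ ↦ 0 := by
      filter_upwards [(isOpen_lt hcont continuous_const).mem_nhds h] with z hz
      exact radialTransition_comp_spatial_of_norm_le hR' (le_of_lt hz)
    rw [hev.fderiv_eq]
    simp
  · have hev : (fun x : E4 ↦ radialTransition R' R' (E4.spatial x)) =ᶠ[𝓝 x] fun _ ↦ 1 := by
      filter_upwards [(isOpen_lt continuous_const hcont).mem_nhds h] with z hz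
      exact radialTransition_comp_spatial_of_le hR' (le_of_lt hz)
    rw [hev.fderiv_eq]
    simp

/-! ### The wave and its currents in the far region -/

variable [Facts] [SliceFacts]

/-- The extension by zero `ψ̃` of an admissible wave is `C^∞` at the points of the exterior.
[folklore] -/
theorem _root_.Literature.Geometry.Lorentzian.IsAdmissibleKerrWave.contDiffAt_extend_of_mem
    {M a : ℝ} {ψ : region a (rPlus M a) → ℝ} (hψ : IsAdmissibleKerrWave M a ψ) {x : E4}
    (hx : x ∈ region a (rPlus M a)) {n : ℕ∞} :
    ContDiffAt ℝ n (Function.extend Subtype.val ψ 0) x :=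
  (contDiffAt_extend hψ.1 ⟨x, hx⟩).of_le (by exact_mod_cast le_top)

/-- **`□ ψ̃ = 0` in the chart**: at every exterior point the divergence-form wave operator of the
Kerr inverse metric (`KerrSchild.waveOperator (Kerr.inverseMetric M a)`) of the extension by zero
of an admissible wave vanishes (`Kerr.dalembertian_eq_divergence` and `□_g ψ = 0`). DRSR
arXiv:1402.7034, §2.3. [cite: DafermosRodnianskiShlapentokhrothman2014, §2.3] -/
theorem _root_.Literature.Geometry.Lorentzian.IsAdmissibleKerrWave.waveOperator_extend_eq_zero
    {M a : ℝ} {ψ : region a (rPlus M a) → ℝ} (hψ : IsAdmissibleKerrWave M a ψ) {x : E4}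
    (hx : x ∈ region a (rPlus M a)) :
    KerrSchild.waveOperator (inverseMetric M a) (Function.extend Subtype.val ψ 0) x = 0 := by
  have h := dalembertian_eq_divergence M a (rPlus M a) (extend_rep ψ) ⟨x, hx⟩
    (hψ.contDiffAt_extend_of_mem hx)
  rw [hψ.2.1 ⟨x, hx⟩] at h
  exact h.symm

omit [Facts] [SliceFacts] in
/-- **The bulk of the Killing multiplier `∂_{t*}` vanishes**: `K^{∂_0}[g⁻¹_{M,a}] = 0` at every
point with `r > 0` (`∂X = 0` and `∂_0 g^{αβ} = 0`, `Kerr.fderiv_inverseMetric_basisVector_zero`).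
DRSR arXiv:1402.7034, §2.3.1 (`K^T = 0` for the Killing field `T`). [cite: DafermosRodnianskiShlapentokhrothman2014, §2.3.1] -/
theorem multiplierBulk_timeTranslation_eq_zero (M a : ℝ) (w : E4 → ℝ) {x : E4}
    (hx : 0 < radius a x) :
    KerrSchild.multiplierBulk (inverseMetric M a) (fun _ ν ↦ if ν = 0 then (1 : ℝ) else 0) w x = 0 := by
  rw [KerrSchild.multiplierBulk_of_fderiv_eq_zero (inverseMetric M a) w
    (fun α ↦ by simp)]
  simp [fderiv_inverseMetric_basisVector_zero M a hx]

/-- The data of an admissible wave are supported in some coordinate ball: there is `ρ₀ ≥ 0` with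
`ψ = 0`, `dψ = 0` at the slice points `{t* = 0, ‖x⃗‖ > ρ₀}` (the compact `K` of the definition has
bounded spatial radius). DRSR arXiv:1402.7034, §4.1. [cite: DafermosRodnianskiShlapentokhrothman2014, §4.1] -/
theorem _root_.Literature.Geometry.Lorentzian.IsAdmissibleKerrWave.exists_data_eq_zero
    {M a : ℝ} {ψ : region a (rPlus M a) → ℝ} (hψ : IsAdmissibleKerrWave M a ψ) :
    ∃ ρ₀ : ℝ, 0 ≤ ρ₀ ∧ ∀ x : region a (rPlus M a), (x : E4) 0 = 0 → ρ₀ < E4.spatialNorm (x : E4) →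
      ψ x = 0 ∧ mfderiv 𝓘(ℝ, E4) 𝓘(ℝ, ℝ) ψ x = 0 := by
  obtain ⟨K, hK, hvan⟩ := hψ.2.2
  obtain ⟨ρ₀, hρ₀, hKρ⟩ := exists_spatialNorm_le_of_isCompact hK
  refine ⟨ρ₀, hρ₀, fun x hx0 hxρ ↦ hvan x hx0 fun hxK ↦ ?_⟩
  exact absurd (hKρ x hxK) (not_le.2 hxρ)

omit [Facts] [SliceFacts] in
/-- At an exterior point where `dψ = 0` (manifold differential), the Fréchet differential of the
extension by zero vanishes. [folklore] -/
theorem fderiv_extend_eq_zero_of_mfderiv_eq_zero {M a : ℝ} {ψ : region a (rPlus M a) → ℝ}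
    (x : region a (rPlus M a)) (hx : mfderiv 𝓘(ℝ, E4) 𝓘(ℝ, ℝ) ψ x = 0) :
    fderiv ℝ (Function.extend Subtype.val ψ 0) x.1 = 0 := by
  ext v
  rw [← mvfderiv_eq_fderiv_extend]
  change (mfderiv 𝓘(ℝ, E4) 𝓘(ℝ, ℝ) ψ x) v = 0
  rw [hx]
  rfl

/-- **Support below a time level (finite speed of propagation).** For an admissible wave `ψ` on
subextremal Kerr there is `ρ₀ ≥ 0` such that its extension by zero satisfies `ψ̃(x) = 0` and
`dψ̃(x) = 0` at every `x ∈ ℝ⁴` with `x⁰ ≥ 0` and `‖x⃗‖ > ρ₀ + x⁰` (such a point lies in the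
exterior once `‖x⃗‖ > R_af`, and there `kerr_finite_speed_of_propagation_holds` applies; at the
remaining points `ψ̃` need not vanish, so the radius is taken `≥ R_af`). Hence the cut-off
currents of `ψ̃` vanish on the far part `{‖x⃗‖ > ρ₀ + T}` of any wedge above `{t* = 0}` below the
time level `T`. DRSR arXiv:1402.7034, §4.1; Moschidis arXiv:1509.08489, §4.
[cite: DafermosRodnianskiShlapentokhrothman2014, §4.1] -/
theorem _root_.Literature.Geometry.Lorentzian.IsAdmissibleKerrWave.exists_extend_eq_zero_of_lt
    {M a : ℝ} (hMa : IsSubextremal M a) {ψ : region a (rPlus M a) → ℝ}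
    (hψ : IsAdmissibleKerrWave M a ψ) :
    ∃ ρ₀ : ℝ, afRadius a (rPlus M a) ≤ ρ₀ ∧ ∀ x : E4, 0 ≤ x 0 → ρ₀ + x 0 < E4.spatialNorm x →
      Function.extend Subtype.val ψ 0 x = 0 ∧ fderiv ℝ (Function.extend Subtype.val ψ 0) x = 0 := by
  obtain ⟨ρ₁, hρ₁, hdata⟩ := hψ.exists_data_eq_zero
  refine ⟨max ρ₁ (afRadius a (rPlus M a)), le_max_right _ _, fun x hx0 hxρ ↦ ?_⟩
  have hxaf : afRadius a (rPlus M a) < E4.spatialNorm x := by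
    have := le_max_right ρ₁ (afRadius a (rPlus M a)); linarith
  have hx : x ∈ region a (rPlus M a) := mem_region_of_afRadius_lt_spatialNorm hxaf
  have hρ : ρ₁ + x 0 < E4.spatialNorm x := by
    have := le_max_left ρ₁ (afRadius a (rPlus M a)); linarith
  have hfsp := kerr_finite_speed_of_propagation_holds M a hMa ψ hψ.1 hψ.2.1 ρ₁
    (fun z hz0 hzρ ↦ hdata z hz0 hzρ) ⟨x, hx⟩ hx0 hρ
  exact ⟨by rw [← extend_rep ψ ⟨x, hx⟩]; exact hfsp.1,
    fderiv_extend_eq_zero_of_mfderiv_eq_zero ⟨x, hx⟩ hfsp.2⟩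

/-! ### The cut-off error is a local energy -/

omit [Facts] [SliceFacts] in
/-- `|g^{αβ}| ≤ 2` where `2H ≤ 1` (`|g^{αβ} − η^{αβ}| ≤ 2H`, `|η^{αβ}| ≤ 1`). [folklore] -/
theorem abs_inverseMetric_le_two {M a : ℝ} (hM : 0 ≤ M) {x : E4} (hx : 0 < radius a x)
    (hH : 2 * scalarH M a x ≤ 1) (α β : Fin 4) : |inverseMetric M a x α β| ≤ 2 := by
  have h := abs_inverseMetric_sub_etaComp_le hM a hx α β
  have hη : |etaComp α β| ≤ 1 := by
    unfold etaComp
    split_ifs <;> simp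
  calc |inverseMetric M a x α β|
      = |(inverseMetric M a x α β - etaComp α β) + etaComp α β| := by ring_nf
    _ ≤ |inverseMetric M a x α β - etaComp α β| + |etaComp α β| := abs_add_le _ _
    _ ≤ 1 + 1 := add_le_add (h.trans hH) hη
    _ = 2 := by norm_num

omit [Facts] [SliceFacts] in
/-- **The cut-off error term is bounded by the coordinate energy**: for the Kerr inverse metric at
a point with `2H ≤ 1`, a multiplier with `|X^α(x)| ≤ ξ₀` and a cut-off with `|∂_μ f(x)| ≤ ν₀`,
`|∑_μ (J^X)^μ(x) ∂_μ f(x)| ≤ 48 ξ₀ ν₀ ∑_μ (∂_μ w)²(x)` (`KerrSchild.abs_sum_multiplierCurrent_mul_le_of_coeff`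
with `|g^{αβ}| ≤ 2`). DRSR arXiv:1402.7034, Remark 2.3.1 (errors from cut-offs); Moschidis
arXiv:1509.08489, Lemmas 4.1, 4.5 (`∫ |∂χ_R| |∂φ|²`). [cite: Moschidis2016, Lemma 4.5] -/
theorem abs_sum_multiplierCurrent_mul_fderiv_le {M a : ℝ} (hM : 0 ≤ M) {x : E4}
    (hx : 0 < radius a x) (hH : 2 * scalarH M a x ≤ 1) {X : E4 → Fin 4 → ℝ} {w f : E4 → ℝ}
    {ξ₀ ν₀ : ℝ} (hξ₀ : 0 ≤ ξ₀) (hν₀ : 0 ≤ ν₀) (hX : ∀ α, |X x α| ≤ ξ₀)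
    (hf : ∀ μ, |fderiv ℝ f x (E4.basisVector μ)| ≤ ν₀) :
    |∑ μ, KerrSchild.multiplierCurrent (inverseMetric M a) X w x μ * fderiv ℝ f x (E4.basisVector μ)| ≤
      48 * ξ₀ * ν₀ * ∑ μ, fderiv ℝ w x (E4.basisVector μ) ^ 2 := by
  have h := KerrSchild.abs_sum_multiplierCurrent_mul_le_of_coeff (inverseMetric M a) X w x
    (fun μ ↦ fderiv ℝ f x (E4.basisVector μ)) (h₀ := 2) zero_le_two hξ₀ hν₀
    (fun α β ↦ abs_inverseMetric_le_two hM hx hH α β) hX hf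
  calc _ ≤ 24 * 2 * ξ₀ * ν₀ * ∑ μ, fderiv ℝ w x (E4.basisVector μ) ^ 2 := h
    _ = 48 * ξ₀ * ν₀ * ∑ μ, fderiv ℝ w x (E4.basisVector μ) ^ 2 := by ring

omit [SliceFacts] in
/-- **The coordinate energy of the representative is at most `4 T[ψ](V, V)`** at exterior points
(`Kerr.sum_sq_mvfderiv_le_four_mul_stressEnergy` for the extension by zero). DRSR
arXiv:1402.7034, §3.1 (28). [cite: DafermosRodnianskiShlapentokhrothman2014, §3.1 (28)] -/
theorem sum_sq_fderiv_extend_le_four_mul_stressEnergy {M a : ℝ} (hM : 0 ≤ M)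
    (ψ : region a (rPlus M a) → ℝ) (x : region a (rPlus M a)) :
    ∑ μ, fderiv ℝ (Function.extend Subtype.val ψ 0) x.1 (E4.basisVector μ) ^ 2 ≤
      4 * (smoothMetric M a (rPlus M a)).stressEnergy ψ x (timeVector M a x.1) (timeVector M a x.1) := by
  have h := sum_sq_mvfderiv_le_four_mul_stressEnergy hM ψ x
  simp only [mvfderiv_eq_fderiv_extend] at h
  exact h

end Kerr

end Literature.Geometry.Lorentzian

namespace Literature.Geometry.Lorentzian

/-! ### Continuity of cut-off products -/

/-- **A continuous cut-off times a function continuous near the support of the cut-off is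
continuous** (companion of `E4.contDiff_mul_of_tsupport_subset`). [folklore] -/
theorem continuous_mul_of_tsupport_subset {α : Type*} [TopologicalSpace α] {f g : α → ℝ}
    {U : Set α} (hfU : tsupport f ⊆ U) (hf : Continuous f) (hg : ∀ x ∈ U, ContinuousAt g x) :
    Continuous fun x ↦ f x * g x := by
  refine continuous_iff_continuousAt.2 fun x ↦ ?_
  by_cases hx : x ∈ U
  · exact hf.continuousAt.mul (hg x hx)
  · have hx' : x ∉ tsupport f := fun h ↦ hx (hfU h)
    have hev : (fun y ↦ f y * g y) =ᶠ[𝓝 x] fun _ ↦ 0 := by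
      filter_upwards [notMem_tsupport_iff_eventuallyEq.mp hx'] with y hy
      simp [hy]
    exact continuousAt_const.congr_of_eventuallyEq hev

/-- The topological support of a product lies in that of either factor. [folklore] -/
theorem tsupport_mul_subset_left' {α : Type*} [TopologicalSpace α] (f g : α → ℝ) :
    tsupport (fun x ↦ f x * g x) ⊆ tsupport f :=
  tsupport_mul_subset_left

namespace E4

/-! ### The space-time integral over a wedge as an integral on `ℝ × E3` -/

/-- **Integrability of a wedge-truncated continuous integrand.** For `Φ` continuous on `ℝ × E3`,
continuous `a, b`, and `Φ` vanishing at the points of the wedge `{a(y) < t ≤ b(y)}` outside a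
bounded set `[t₀, t₁] × B̄_ρ`, the function `1_{a(y) < t ≤ b(y)} Φ(t, y)` is integrable on `ℝ × E3`.
[folklore] -/
theorem integrable_indicator_wedge {Φ : ℝ → E3 → ℝ} (hΦ : Continuous (Function.uncurry Φ))
    {a b : E3 → ℝ} (ha : Continuous a) (hb : Continuous b) {t₀ t₁ ρ : ℝ}
    (hsupp : ∀ t y, a y < t → t ≤ b y → Φ t y ≠ 0 → t ∈ Set.Icc t₀ t₁ ∧ ‖y‖ ≤ ρ) :
    Integrable ({p : ℝ × E3 | a p.2 < p.1 ∧ p.1 ≤ b p.2}.indicator (Function.uncurry Φ))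
      ((volume : Measure ℝ).prod (volume : Measure E3)) := by
  set W : Set (ℝ × E3) := {p | a p.2 < p.1 ∧ p.1 ≤ b p.2} with hW
  have hWm : MeasurableSet W :=
    (measurableSet_lt (ha.measurable.comp measurable_snd) measurable_fst).inter
      (measurableSet_le measurable_fst (hb.measurable.comp measurable_snd))
  have hK : IsCompact (Set.Icc t₀ t₁ ×ˢ Metric.closedBall (0 : E3) ρ) :=
    isCompact_Icc.prod (isCompact_closedBall _ _)
  have hsupp' : Function.support (W.indicator (Function.uncurry Φ)) ⊆
      Set.Icc t₀ t₁ ×ˢ Metric.closedBall (0 : E3) ρ := by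
    intro p hp
    rw [Function.mem_support] at hp
    have hpW : p ∈ W := by
      by_contra h
      exact hp (Set.indicator_of_notMem h _)
    rw [Set.indicator_of_mem hpW] at hp
    obtain ⟨ht, hy⟩ := hsupp p.1 p.2 hpW.1 hpW.2 hp
    exact ⟨ht, by simpa using hy⟩
  rw [← Measure.volume_eq_prod, ← integrableOn_iff_integrable_of_support_subset hsupp']
  exact (hΦ.continuousOn.integrableOn_compact hK).indicator hWm

/-- **The iterated space-time integral over a wedge as one integral on `ℝ × E3`.** Under the
hypotheses of `integrable_indicator_wedge`,
`∫ ( ∫_{t ∈ (a(y), b(y)]} Φ(t, y) dt ) dy = ∫_{ℝ × E3} 1_{a(y) < t ≤ b(y)} Φ(t, y) d(t, y)`. In this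
form, pointwise inequalities between wedge integrands integrate (`integral_mono` with
`integrable_indicator_wedge`). [folklore] -/
theorem integral_integral_Ioc_eq_integral_indicator {Φ : ℝ → E3 → ℝ}
    (hΦ : Continuous (Function.uncurry Φ)) {a b : E3 → ℝ} (ha : Continuous a) (hb : Continuous b)
    {t₀ t₁ ρ : ℝ}
    (hsupp : ∀ t y, a y < t → t ≤ b y → Φ t y ≠ 0 → t ∈ Set.Icc t₀ t₁ ∧ ‖y‖ ≤ ρ) :
    ∫ y, ∫ t in Set.Ioc (a y) (b y), Φ t y =
      ∫ p, {p : ℝ × E3 | a p.2 < p.1 ∧ p.1 ≤ b p.2}.indicator (Function.uncurry Φ) p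
        ∂((volume : Measure ℝ).prod (volume : Measure E3)) := by
  set W : Set (ℝ × E3) := {p | a p.2 < p.1 ∧ p.1 ≤ b p.2} with hW
  have hint := integrable_indicator_wedge hΦ ha hb hsupp
  have hy : ∀ y, ∫ t in Set.Ioc (a y) (b y), Φ t y = ∫ t, W.indicator (Function.uncurry Φ) (t, y) := by
    intro y
    rw [← integral_indicator measurableSet_Ioc]
    refine integral_congr_ae (Filter.Eventually.of_forall fun t ↦ ?_)
    change _ = W.indicator (Function.uncurry Φ) (t, y)
    by_cases ht : t ∈ Set.Ioc (a y) (b y)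
    · rw [Set.indicator_of_mem ht, Set.indicator_of_mem (show (t, y) ∈ W from ht)]
      rfl
    · rw [Set.indicator_of_notMem ht, Set.indicator_of_notMem (show (t, y) ∉ W from ht)]
  simp only [hy]
  rw [integral_prod _ hint]
  exact integral_integral_swap hint.swap

/-- **Monotonicity of wedge integrals**: a pointwise inequality `Φ₁ ≤ Φ₂` at the points of the wedge
between two wedge-truncated continuous integrands integrates to
`∫∫_{wedge} Φ₁ ≤ ∫∫_{wedge} Φ₂`. [folklore] -/
theorem integral_integral_Ioc_mono {Φ₁ Φ₂ : ℝ → E3 → ℝ}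
    (hΦ₁ : Continuous (Function.uncurry Φ₁)) (hΦ₂ : Continuous (Function.uncurry Φ₂))
    {a b : E3 → ℝ} (ha : Continuous a) (hb : Continuous b) {t₀ t₁ ρ : ℝ}
    (hsupp₁ : ∀ t y, a y < t → t ≤ b y → Φ₁ t y ≠ 0 → t ∈ Set.Icc t₀ t₁ ∧ ‖y‖ ≤ ρ)
    (hsupp₂ : ∀ t y, a y < t → t ≤ b y → Φ₂ t y ≠ 0 → t ∈ Set.Icc t₀ t₁ ∧ ‖y‖ ≤ ρ)
    (hle : ∀ t y, a y < t → t ≤ b y → Φ₁ t y ≤ Φ₂ t y) :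
    ∫ y, ∫ t in Set.Ioc (a y) (b y), Φ₁ t y ≤ ∫ y, ∫ t in Set.Ioc (a y) (b y), Φ₂ t y := by
  rw [integral_integral_Ioc_eq_integral_indicator hΦ₁ ha hb hsupp₁,
    integral_integral_Ioc_eq_integral_indicator hΦ₂ ha hb hsupp₂]
  refine integral_mono (integrable_indicator_wedge hΦ₁ ha hb hsupp₁)
    (integrable_indicator_wedge hΦ₂ ha hb hsupp₂) fun p ↦ ?_
  by_cases hp : p ∈ {p : ℝ × E3 | a p.2 < p.1 ∧ p.1 ≤ b p.2}
  · rw [Set.indicator_of_mem hp, Set.indicator_of_mem hp]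
    exact hle p.1 p.2 hp.1 hp.2
  · rw [Set.indicator_of_notMem hp, Set.indicator_of_notMem hp]

/-- **A non-negative wedge integral as a Lebesgue integral** (Tonelli on `ℝ × E3`): under the
hypotheses of `integrable_indicator_wedge` and `Φ ≥ 0` on the wedge,
`ENNReal.ofReal (∫∫_{wedge} Φ) = ∫⁻_t ∫⁻_y 1_{a(y) < t ≤ b(y)} ofReal(Φ(t, y))`, the form in which
it is compared with time integrals of energies through the slices. [folklore] -/
theorem ofReal_integral_integral_Ioc_eq_lintegral {Φ : ℝ → E3 → ℝ}
    (hΦ : Continuous (Function.uncurry Φ)) {a b : E3 → ℝ} (ha : Continuous a) (hb : Continuous b)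
    {t₀ t₁ ρ : ℝ}
    (hsupp : ∀ t y, a y < t → t ≤ b y → Φ t y ≠ 0 → t ∈ Set.Icc t₀ t₁ ∧ ‖y‖ ≤ ρ)
    (hnn : ∀ t y, a y < t → t ≤ b y → 0 ≤ Φ t y) :
    ENNReal.ofReal (∫ y, ∫ t in Set.Ioc (a y) (b y), Φ t y) =
      ∫⁻ t, ∫⁻ y, {p : ℝ × E3 | a p.2 < p.1 ∧ p.1 ≤ b p.2}.indicator
        (fun p ↦ ENNReal.ofReal (Function.uncurry Φ p)) (t, y) := by
  set W : Set (ℝ × E3) := {p | a p.2 < p.1 ∧ p.1 ≤ b p.2} with hW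
  have hWm : MeasurableSet W :=
    (measurableSet_lt (ha.measurable.comp measurable_snd) measurable_fst).inter
      (measurableSet_le measurable_fst (hb.measurable.comp measurable_snd))
  have hint := integrable_indicator_wedge hΦ ha hb hsupp
  rw [integral_integral_Ioc_eq_integral_indicator hΦ ha hb hsupp,
    ofReal_integral_eq_lintegral_ofReal hint]
  · rw [lintegral_prod _]
    · refine lintegral_congr fun t ↦ lintegral_congr fun y ↦ ?_
      by_cases hp : (t, y) ∈ W
      · rw [Set.indicator_of_mem hp, Set.indicator_of_mem hp]
      · rw [Set.indicator_of_notMem hp, Set.indicator_of_notMem hp, ENNReal.ofReal_zero]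
    · exact (ENNReal.measurable_ofReal.comp
        (hΦ.measurable.indicator hWm)).aemeasurable
  · refine Filter.Eventually.of_forall fun p ↦ ?_
    by_cases hp : p ∈ W
    · rw [Set.indicator_of_mem hp]
      exact hnn p.1 p.2 hp.1 hp.2
    · rw [Set.indicator_of_notMem hp]
      exact le_rfl

end E4

end Literature.Geometry.Lorentzian

namespace Literature.Geometry.Lorentzian

namespace Kerr

/-! ### Global smoothness and sign of the height `h♯_{R₁}` -/

/-- **`h♯_{R₁}` is `C^∞` on all of `E3`** for `|a| < M`, `R₁ > r₊`: at the points of the exterior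
slice by `Kerr.contDiffAt_scriHeight`, near the remaining points (where `r(0, ·) ≤ r₊ < R₁`) it
vanishes identically (`Kerr.scriHeight_eq_zero_of_radius_le`, the radius being continuous).
[folklore] -/
theorem IsSubextremal.contDiff_scriHeight {M a R₁ : ℝ} (h : IsSubextremal M a)
    (hRp : rPlus M a < R₁) {n : ℕ∞} : ContDiff ℝ n (scriHeight M a R₁) := by
  refine contDiff_iff_contDiffAt.2 fun y ↦ ?_
  by_cases hy : rPlus M a < radius a (E4.ofTimeSpace 0 y)
  · have hmem : y ∈ slice a (rPlus M a) := by
      rw [mem_slice, max_eq_left h.rPlus_pos.le]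
      exact hy
    exact ((contDiffAt_scriHeight h hRp ⟨y, hmem⟩).of_le (by exact_mod_cast le_top))
  · have hlt : radius a (E4.ofTimeSpace 0 y) < R₁ := (not_lt.1 hy).trans_lt hRp
    have hopen : IsOpen {z : E3 | radius a (E4.ofTimeSpace 0 z) < R₁} :=
      isOpen_lt ((continuous_radius a).comp (E4.continuous_ofTimeSpace 0)) continuous_const
    have hev : scriHeight M a R₁ =ᶠ[𝓝 y] fun _ ↦ 0 := by
      filter_upwards [hopen.mem_nhds hlt] with z hz
      exact scriHeight_eq_zero_of_radius_le (h.rPlus_pos.le.trans hRp.le) hz.le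
    exact (contDiffAt_const (c := (0 : ℝ))).congr_of_eventuallyEq hev

/-! ### Continuity of the currents of `ψ̃` in the far region -/

variable [Facts] [SliceFacts]

/-- **The multiplier currents of `ψ̃` are continuous at the exterior points**, for a multiplier
field whose components are `C¹` there: `x ↦ (J^X)^μ[ψ̃](x)` for the Kerr inverse metric
(`KerrSchild.contDiffAt_multiplierCurrent`). [folklore] -/
theorem _root_.Literature.Geometry.Lorentzian.IsAdmissibleKerrWave.continuousAt_multiplierCurrent
    {M a : ℝ} {ψ : region a (rPlus M a) → ℝ} (hψ : IsAdmissibleKerrWave M a ψ)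
    {X : E4 → Fin 4 → ℝ} {x : E4} (hx : x ∈ region a (rPlus M a))
    (hX : ∀ α, ContDiffAt ℝ 1 (fun y ↦ X y α) x) (μ : Fin 4) :
    ContinuousAt (fun y ↦ KerrSchild.multiplierCurrent (inverseMetric M a) X
      (Function.extend Subtype.val ψ 0) y μ) x :=
  (KerrSchild.contDiffAt_multiplierCurrent
    (fun α β ↦ contDiffAt_inverseMetric M a (radius_pos_of_mem_region hx) α β) hX
    (hψ.contDiffAt_extend_of_mem hx) μ).continuousAt

/-- The coordinate energy `x ↦ ∑_μ (∂_μ ψ̃)²(x)` is continuous at the exterior points. [folklore] -/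
theorem _root_.Literature.Geometry.Lorentzian.IsAdmissibleKerrWave.continuousAt_sum_sq_fderiv_extend
    {M a : ℝ} {ψ : region a (rPlus M a) → ℝ} (hψ : IsAdmissibleKerrWave M a ψ) {x : E4}
    (hx : x ∈ region a (rPlus M a)) :
    ContinuousAt (fun y ↦ ∑ μ, fderiv ℝ (Function.extend Subtype.val ψ 0) y (E4.basisVector μ) ^ 2) x := by
  have h2 : ContDiffAt ℝ 2 (Function.extend Subtype.val ψ 0) x := hψ.contDiffAt_extend_of_mem hx
  have hp : ∀ κ, ContinuousAt (fun y ↦ fderiv ℝ (Function.extend Subtype.val ψ 0) y (E4.basisVector κ)) x :=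
    fun κ ↦ ((h2.fderiv_right (m := 1) le_rfl).continuousAt.clm_apply continuousAt_const)
  exact (continuous_finsetSum _ fun μ _ ↦ (continuous_apply μ).pow 2).continuousAt.comp
    (continuousAt_pi.2 hp) |>.congr (Filter.Eventually.of_forall fun _ ↦ rfl)

/-- **A cut-off current of `ψ̃` is continuous on `ℝ⁴`**: for a continuous cut-off factor `c` on `ℝ⁴`
(e.g. `f`, `∂_μ f`) with `tsupport c ⊆ {‖x⃗‖ > R_af}` and a multiplier with `C¹` components on that
far region, `x ↦ c(x) (J^X)^μ[ψ̃](x)` is continuous. [folklore] -/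
theorem _root_.Literature.Geometry.Lorentzian.IsAdmissibleKerrWave.continuous_mul_multiplierCurrent
    {M a : ℝ} {ψ : region a (rPlus M a) → ℝ} (hψ : IsAdmissibleKerrWave M a ψ)
    {X : E4 → Fin 4 → ℝ} {c : E4 → ℝ} (hc : Continuous c)
    (hcU : tsupport c ⊆ {x : E4 | afRadius a (rPlus M a) < E4.spatialNorm x})
    (hX : ∀ z : E4, afRadius a (rPlus M a) < E4.spatialNorm z → ∀ α, ContDiffAt ℝ 1 (fun y ↦ X y α) z)
    (μ : Fin 4) :
    Continuous fun x ↦ c x * KerrSchild.multiplierCurrent (inverseMetric M a) X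
      (Function.extend Subtype.val ψ 0) x μ :=
  continuous_mul_of_tsupport_subset hcU hc fun x hx ↦
    hψ.continuousAt_multiplierCurrent (mem_region_of_afRadius_lt_spatialNorm hx) (hX x hx) μ

/-- The coordinate energy of `ψ̃` times a far cut-off factor is continuous on `ℝ⁴`. [folklore] -/
theorem _root_.Literature.Geometry.Lorentzian.IsAdmissibleKerrWave.continuous_mul_sum_sq_fderiv_extend
    {M a : ℝ} {ψ : region a (rPlus M a) → ℝ} (hψ : IsAdmissibleKerrWave M a ψ) {c : E4 → ℝ}
    (hc : Continuous c) (hcU : tsupport c ⊆ {x : E4 | afRadius a (rPlus M a) < E4.spatialNorm x}) :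
    Continuous fun x ↦ c x *
      ∑ μ, fderiv ℝ (Function.extend Subtype.val ψ 0) x (E4.basisVector μ) ^ 2 :=
  continuous_mul_of_tsupport_subset hcU hc fun _ hx ↦
    hψ.continuousAt_sum_sq_fderiv_extend (mem_region_of_afRadius_lt_spatialNorm hx)

omit [Facts] [SliceFacts] in
/-- The topological support of `|u|` is that of `u`. [folklore] -/
theorem tsupport_abs {α : Type*} [TopologicalSpace α] (u : α → ℝ) :
    tsupport (fun x ↦ |u x|) = tsupport u := by
  unfold tsupport
  congr 1
  ext x
  simp

omit [Facts] [SliceFacts] in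
/-- The topological support of `∂_v f` lies in that of `f`, and so does that of `|∂_v f|`.
[folklore] -/
theorem tsupport_abs_fderiv_apply_subset (f : E4 → ℝ) (v : E4) :
    tsupport (fun x ↦ |fderiv ℝ f x v|) ⊆ tsupport f := by
  rw [tsupport_abs]
  exact tsupport_fderiv_apply_subset ℝ v

/-! ### The pointwise package at a far point -/

/-- **The pointwise facts at a point of the far region used by every far-region estimate.** For
`|a| < M`, `R₁ > 2M`, an admissible `ψ` with representative `Φ = ψ̃`, and a point `x` with
`‖x⃗‖ ≥ R'`, `R' > R_af`, `R' ≥ 9M`: `x` lies in the exterior, `H(x) ≤ 1/8`, and with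
`(J^T)^μ`, `(J^V)^μ` the currents of `∂_{t*}` and `V` and `n` the graph conormal of `h♯_{R₁}` at `x⃗`,
`0 ≤ −∑(J^T)^μ n_μ ≤ −∑(J^V)^μ n_μ ≤ 2(−∑(J^T)^μ n_μ)` and `0 ≤ −(J^T)⁰`
(`KerrLeafEnergyComparison.lean`). [cite: DafermosRodnianskiShlapentokhrothman2014, §3.1 and §3.3] -/
theorem far_point_package {M a R₁ R' : ℝ} (hMa : IsSubextremal M a) (hR₁ : 2 * M < R₁)
    (hR'af : afRadius a (rPlus M a) < R') (hR'9 : 9 * M ≤ R') {ψ : region a (rPlus M a) → ℝ}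
    (hψ : IsAdmissibleKerrWave M a ψ) {x : E4} (hx : R' ≤ E4.spatialNorm x) :
    x ∈ region a (rPlus M a) ∧ scalarH M a x ≤ 1 / 8 ∧
      (0 ≤ -∑ μ, KerrSchild.multiplierCurrent (inverseMetric M a)
          (fun _ ν ↦ if ν = 0 then (1 : ℝ) else 0) (Function.extend Subtype.val ψ 0) x μ *
            graphConormal (scriHeight M a R₁) (E4.spatial x) μ) ∧
      (-∑ μ, KerrSchild.multiplierCurrent (inverseMetric M a)
          (fun _ ν ↦ if ν = 0 then (1 : ℝ) else 0) (Function.extend Subtype.val ψ 0) x μ *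
            graphConormal (scriHeight M a R₁) (E4.spatial x) μ ≤
        -∑ μ, KerrSchild.multiplierCurrent (inverseMetric M a) (fun z α ↦ timeVector M a z α)
          (Function.extend Subtype.val ψ 0) x μ * graphConormal (scriHeight M a R₁) (E4.spatial x) μ) ∧
      (-∑ μ, KerrSchild.multiplierCurrent (inverseMetric M a) (fun z α ↦ timeVector M a z α)
          (Function.extend Subtype.val ψ 0) x μ * graphConormal (scriHeight M a R₁) (E4.spatial x) μ ≤
        2 * -∑ μ, KerrSchild.multiplierCurrent (inverseMetric M a)
          (fun _ ν ↦ if ν = 0 then (1 : ℝ) else 0) (Function.extend Subtype.val ψ 0) x μ *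
            graphConormal (scriHeight M a R₁) (E4.spatial x) μ) ∧
      0 ≤ -KerrSchild.multiplierCurrent (inverseMetric M a)
          (fun _ ν ↦ if ν = 0 then (1 : ℝ) else 0) (Function.extend Subtype.val ψ 0) x 0 := by
  have hxaf : afRadius a (rPlus M a) < E4.spatialNorm x := hR'af.trans_le hx
  have hmem : x ∈ region a (rPlus M a) := mem_region_of_afRadius_lt_spatialNorm hxaf
  have hH : scalarH M a x ≤ 1 / 8 := scalarH_le_one_div_eight_of_le_spatialNorm hMa (hR'9.trans hx)
  have hΦ : DifferentiableAt ℝ (Function.extend Subtype.val ψ 0) x :=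
    differentiableAt_extend_of_mem hψ.1 hmem
  have hleaf := neg_sum_tMultiplierCurrent_leaf_comparison hMa hR₁ (extend_rep ψ) ⟨x, hmem⟩ hH hΦ
  have hslice := neg_tMultiplierCurrent_slice_comparison hMa.pos (extend_rep ψ) ⟨x, hmem⟩ hH hΦ
  exact ⟨hmem, hH, hleaf.1, hleaf.2.1, hleaf.2.2, hslice.1⟩

end Kerr

end Literature.Geometry.Lorentzian
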